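import Summits.QuantumFields.YangMills.Theorems.ColdStartUniversalityColdStartSolutionsExistTruncatedBounds
import Mathlib.Probability.Process.Adapted
import HarnessLib

/-!
# Route `ColdStartUniversality`, support item S (stmt-QuantumFields-24811), line `piwiener`:
# progressive measurability of vector processes and of tame coefficients along them

Helper file (lead `ym-line-csu-p1`) for the two OPEN registered stubs A (`stub_ambientStrongExistence`,
vector Picard) and B (`stub_frobeniusNormPreserved`, vector Itô product rule) of the skeleton
`Cruxes/ColdStartSolutionsExist/Lines/piwiener.lean`.  Both provers first need: the Itô integrands
`(s, ω) ↦ σ̃_{e,n}(X_s(ω))_{ij}` (real and imaginary parts) are PROGRESSIVE for the joint raw filtration when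
the solution `X` is entrywise progressive (as `IsAmbientSolution` records) and the coefficient field is tame
(squared-Frobenius Lipschitz ⇒ continuous ⇒ Borel).  Generic, filtration-agnostic statements:

* `isStronglyProgressive_pi` — finitely many real progressive processes form a progressive `ℝ^ι`-valued process;
* `isStronglyProgressive_complexPi_of_re_im` — a `(κ → ℂ)`-valued process is progressive when the real and
  imaginary parts of all its coordinates are;
* `IsStronglyProgressive.measurable_comp_pi` — post-composition with a Borel map `(κ → ℂ) → ℝ` preserves
  progressivity;
* `continuous_of_hsForm_lipschitz` — a coefficient map `f : M₂(ℂ)^E → M₂(ℂ)` with the tame bound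
  `‖f Q − f Q'‖_F² ≤ K Σ_e' ‖Q e' − Q' e'‖_F²` (tree `hsForm`) is continuous;
* `isStronglyProgressive_coeff_re/_im` — hence `(t, ω) ↦ Re/Im (f (X t ω))_{ij}` is progressive for every
  entrywise-progressive matrix-configuration process `X`.

No definition, no sorry, standard axioms.  RECORD-rung plumbing; nothing here bears on the mass gap.
-/

set_option autoImplicit false

noncomputable section

namespace Summit.QuantumFields.YangMills.Theorems.ColdStartUniversality

open MeasureTheory Filter Topology Matrix
open scoped NNReal BigOperators Matrix.Norms.Frobenius
open Literature.MathematicalPhysics.QuantumFieldTheory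

section Generic

variable {Ω : Type*} {m : MeasurableSpace Ω} {𝓕 : Filtration ℝ≥0 m}

/-- **Finitely many real progressive processes form a progressive vector process.** [folklore] -/
theorem isStronglyProgressive_pi {ι : Type*} [Fintype ι] {X : ι → ℝ≥0 → Ω → ℝ}
    (h : ∀ i, IsStronglyProgressive 𝓕 (X i)) :
    IsStronglyProgressive 𝓕 (fun t ω => fun i => X i t ω) := by
  intro t
  letI : MeasurableSpace (Set.Iic t × Ω) := Subtype.instMeasurableSpace.prod (𝓕 t)
  exact (measurable_pi_lambda _ fun i => (h i t).measurable).stronglyMeasurable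

/-- A complex-valued process is progressive when its real and imaginary parts are. [folklore] -/
theorem isStronglyProgressive_complex_of_re_im {Z : ℝ≥0 → Ω → ℂ}
    (hre : IsStronglyProgressive 𝓕 (fun t ω => (Z t ω).re))
    (him : IsStronglyProgressive 𝓕 (fun t ω => (Z t ω).im)) : IsStronglyProgressive 𝓕 Z := by
  intro t
  letI : MeasurableSpace (Set.Iic t × Ω) := Subtype.instMeasurableSpace.prod (𝓕 t)
  have hm : Measurable (fun p : Set.Iic t × Ω => (((Z p.1 p.2).re : ℝ) : ℂ) + (((Z p.1 p.2).im : ℝ) : ℂ) * Complex.I) :=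
    (Complex.measurable_ofReal.comp (hre t).measurable).add
      ((Complex.measurable_ofReal.comp (him t).measurable).mul_const _)
  have heq : (fun p : Set.Iic t × Ω => Z p.1 p.2) =
      fun p : Set.Iic t × Ω => (((Z p.1 p.2).re : ℝ) : ℂ) + (((Z p.1 p.2).im : ℝ) : ℂ) * Complex.I := by
    funext p; exact (Complex.re_add_im (Z p.1 p.2)).symm
  rw [heq]
  exact hm.stronglyMeasurable

/-- **A `(κ → ℂ)`-valued process is progressive when the real and imaginary parts of all its coordinates
are.** [folklore] -/
theorem isStronglyProgressive_complexPi_of_re_im {κ : Type*} [Fintype κ] {X : ℝ≥0 → Ω → (κ → ℂ)}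
    (hre : ∀ k, IsStronglyProgressive 𝓕 (fun t ω => (X t ω k).re))
    (him : ∀ k, IsStronglyProgressive 𝓕 (fun t ω => (X t ω k).im)) : IsStronglyProgressive 𝓕 X := by
  have hk : ∀ k, IsStronglyProgressive 𝓕 (fun t ω => X t ω k) := fun k =>
    isStronglyProgressive_complex_of_re_im (hre k) (him k)
  intro t
  letI : MeasurableSpace (Set.Iic t × Ω) := Subtype.instMeasurableSpace.prod (𝓕 t)
  exact (measurable_pi_lambda _ fun k => (hk k t).measurable).stronglyMeasurable

/-- Post-composition with a Borel map into `ℝ` preserves progressivity of a `(κ → ℂ)`-valued process.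
[folklore] -/
theorem IsStronglyProgressive.measurable_comp_pi {κ : Type*} [Fintype κ] {X : ℝ≥0 → Ω → (κ → ℂ)}
    (hX : IsStronglyProgressive 𝓕 X) {g : (κ → ℂ) → ℝ} (hg : Measurable g) :
    IsStronglyProgressive 𝓕 (fun t ω => g (X t ω)) := fun t =>
  (hg.comp (hX t).measurable).stronglyMeasurable

end Generic

/-! ### Tame coefficient fields are continuous -/

section Tame

variable {L N : ℕ}

/-- **A tame coefficient map is continuous**: if `‖f Q − f Q'‖_F² ≤ K Σ_e' ‖Q e' − Q' e'‖_F²` for all `Q, Q'`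
(the squared-Frobenius Lipschitz bound of `IsTame`, written with the tree's `hsForm`), then `f` is continuous
(Pi topology on `M_N(ℂ)^E`, i.e. entrywise). [folklore] -/
theorem continuous_of_hsForm_lipschitz [NeZero L] {f : MatrixConfig 3 L N → Matrix (Fin N) (Fin N) ℂ}
    {K : ℝ} (hf : ∀ Q Q' : MatrixConfig 3 L N,
      hsForm N (f Q - f Q') (f Q - f Q') ≤ K * ∑ e', hsForm N (Q e' - Q' e') (Q e' - Q' e')) :
    Continuous f := by
  set C : ℝ := max K 0 * (Fintype.card (Edge 3 L) : ℝ) with hC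
  have hC0 : 0 ≤ C := by positivity
  have hK : ∀ Q Q' : MatrixConfig 3 L N, ‖f Q - f Q'‖ ^ 2 ≤ C * ‖Q - Q'‖ ^ 2 := by
    intro Q Q'
    have h := hf Q Q'
    rw [hsForm_self_eq_norm_sq] at h
    simp_rw [hsForm_self_eq_norm_sq] at h
    have hsum : ∑ e', ‖Q e' - Q' e'‖ ^ 2 ≤ (Fintype.card (Edge 3 L) : ℝ) * ‖Q - Q'‖ ^ 2 := by
      calc ∑ e', ‖Q e' - Q' e'‖ ^ 2 ≤ ∑ _e' : Edge 3 L, ‖Q - Q'‖ ^ 2 := by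
            gcongr with e' _
            rw [← Pi.sub_apply]
            exact norm_le_pi_norm (Q - Q') e'
        _ = (Fintype.card (Edge 3 L) : ℝ) * ‖Q - Q'‖ ^ 2 := by
            rw [Finset.sum_const, nsmul_eq_mul, Finset.card_univ]
    have hs0 : 0 ≤ ∑ e', ‖Q e' - Q' e'‖ ^ 2 := Finset.sum_nonneg fun _ _ => by positivity
    calc ‖f Q - f Q'‖ ^ 2 ≤ K * ∑ e', ‖Q e' - Q' e'‖ ^ 2 := h
      _ ≤ max K 0 * ∑ e', ‖Q e' - Q' e'‖ ^ 2 := by gcongr; exact le_max_left _ _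
      _ ≤ max K 0 * ((Fintype.card (Edge 3 L) : ℝ) * ‖Q - Q'‖ ^ 2) := by gcongr
      _ = C * ‖Q - Q'‖ ^ 2 := by rw [hC]; ring
  refine Metric.continuous_iff.2 fun Q ε hε => ?_
  refine ⟨ε / (Real.sqrt C + 1), by positivity, fun Q' hQ' => ?_⟩
  rw [dist_eq_norm] at hQ' ⊢
  have h := hK Q' Q
  have hn : ‖f Q' - f Q‖ ≤ Real.sqrt C * ‖Q' - Q‖ := by
    have h2 : ‖f Q' - f Q‖ ^ 2 ≤ (Real.sqrt C * ‖Q' - Q‖) ^ 2 := by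
      rw [mul_pow, Real.sq_sqrt hC0]; exact h
    exact (pow_le_pow_iff_left₀ (norm_nonneg (f Q' - f Q)) (by positivity) two_ne_zero).1 h2
  calc ‖f Q' - f Q‖ ≤ Real.sqrt C * ‖Q' - Q‖ := hn
    _ ≤ Real.sqrt C * (ε / (Real.sqrt C + 1)) := by gcongr
    _ < ε := by
        rw [mul_div_assoc']
        rw [div_lt_iff₀ (by positivity)]
        nlinarith

/-- Matrix entries, real parts: a continuous coefficient map composed with an entrywise progressive
configuration process is progressive. [folklore] -/
theorem isStronglyProgressive_coeff_re [NeZero L] {Ω : Type*} {m : MeasurableSpace Ω}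
    {𝓕 : Filtration ℝ≥0 m} {f : MatrixConfig 3 L N → Matrix (Fin N) (Fin N) ℂ} (hf : Continuous f)
    {X : ℝ≥0 → Ω → MatrixConfig 3 L N}
    (hre : ∀ e i j, IsStronglyProgressive 𝓕 (fun t ω => (X t ω e i j).re))
    (him : ∀ e i j, IsStronglyProgressive 𝓕 (fun t ω => (X t ω e i j).im)) (i j : Fin N) :
    IsStronglyProgressive 𝓕 (fun t ω => (f (X t ω) i j).re) := by
  -- the configuration as a `(Edge × Fin N × Fin N → ℂ)`-valued process
  have hX : IsStronglyProgressive 𝓕 (fun t ω => fun k : Edge 3 L × Fin N × Fin N => X t ω k.1 k.2.1 k.2.2) :=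
    isStronglyProgressive_complexPi_of_re_im (fun k => hre k.1 k.2.1 k.2.2) (fun k => him k.1 k.2.1 k.2.2)
  -- the coefficient entry as a Borel function of that vector
  have hg : Measurable fun v : Edge 3 L × Fin N × Fin N → ℂ =>
      (f (fun e i' j' => v (e, i', j')) i j).re := by
    have hc : Continuous fun v : Edge 3 L × Fin N × Fin N → ℂ => (fun e i' j' => v (e, i', j') : MatrixConfig 3 L N) :=
      continuous_pi fun e => continuous_pi fun i' => continuous_pi fun j' => continuous_apply _
    have hent : Continuous fun M : Matrix (Fin N) (Fin N) ℂ => M i j :=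
      (continuous_apply j).comp (continuous_apply i)
    exact (Complex.continuous_re.comp (hent.comp (hf.comp hc))).measurable
  exact IsStronglyProgressive.measurable_comp_pi hX hg

/-- Matrix entries, imaginary parts (same statement). [folklore] -/
theorem isStronglyProgressive_coeff_im [NeZero L] {Ω : Type*} {m : MeasurableSpace Ω}
    {𝓕 : Filtration ℝ≥0 m} {f : MatrixConfig 3 L N → Matrix (Fin N) (Fin N) ℂ} (hf : Continuous f)
    {X : ℝ≥0 → Ω → MatrixConfig 3 L N}
    (hre : ∀ e i j, IsStronglyProgressive 𝓕 (fun t ω => (X t ω e i j).re))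
    (him : ∀ e i j, IsStronglyProgressive 𝓕 (fun t ω => (X t ω e i j).im)) (i j : Fin N) :
    IsStronglyProgressive 𝓕 (fun t ω => (f (X t ω) i j).im) := by
  have hX : IsStronglyProgressive 𝓕 (fun t ω => fun k : Edge 3 L × Fin N × Fin N => X t ω k.1 k.2.1 k.2.2) :=
    isStronglyProgressive_complexPi_of_re_im (fun k => hre k.1 k.2.1 k.2.2) (fun k => him k.1 k.2.1 k.2.2)
  have hg : Measurable fun v : Edge 3 L × Fin N × Fin N → ℂ =>
      (f (fun e i' j' => v (e, i', j')) i j).im := by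
    have hc : Continuous fun v : Edge 3 L × Fin N × Fin N → ℂ => (fun e i' j' => v (e, i', j') : MatrixConfig 3 L N) :=
      continuous_pi fun e => continuous_pi fun i' => continuous_pi fun j' => continuous_apply _
    have hent : Continuous fun M : Matrix (Fin N) (Fin N) ℂ => M i j :=
      (continuous_apply j).comp (continuous_apply i)
    exact (Complex.continuous_im.comp (hent.comp (hf.comp hc))).measurable
  exact IsStronglyProgressive.measurable_comp_pi hX hg

end Tame

end Summit.QuantumFields.YangMills.Theorems.ColdStartUniversality

end
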